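import Summits.QuantumFields.BalabanUV.Beta.GAN24.DirichletVertexEnergy

/-!
# `BalabanUV.Beta.GAN24.DirichletVertexDist` — binder row G-an2-4 / (CONV-C), road P2 PART IV, leaf L14 (the torus transfer), FILE C6a:
# THE TORUS RING DISTANCE TO A BLOCK VERTEX, its Lipschitz property and the chart bridge to the push-forward weight `invW`
# (unit b2b-balaban-gan24-p2, gen 27, v1; the family distance `r_V` and the comparison with `ω_V` follow in `DirichletVertexDistV`)

HONEST FRAMING (cell contract, verbatim): «discharging `BetaPertH` makes Bałaban's UV stability UNCONDITIONAL — a real constructive-QFT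
result; it is NOT the continuum limit and NOT the Clay problem.»  SUPPLIER module under the T⁴-DAG sub-row `T4-U1a.S-NE2-D1-DIRICHLET°`
(owner wording R24 «the full rate L⁻¹ beyond boxes OPEN»).  The flux binders (Φ), (Φ′) of the weighted socket
`DirichletBoxWeightedSockets.injected_le_of_weighted` (p234489) are obtained from the weighted trace bounds of `DirichletBoxWeightedTraces`
(p236313), whose RAY SCHEDULE compares the coarse weight `ω_V` of `DirichletVertexEnergy` (p244737) along lattice rays.  Instead of a
Harnack inequality for `ω_V` we use an INTEGER distance: for a block vertex `b` and a site `x` of `Tor (fine n M)` (d = 2) put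
`τ_ν(x) = min(w_ν + 1, n·M_ν − w_ν)`, `w_ν = (x ν − n·b_ν).val`, and `ρ̂_b(x) = max(τ_0, τ_1)` — the sup-distance ring index of `x` around
the vertex on the torus.  It is 1-Lipschitz under unit lattice steps with no case analysis, it equals the model ring index `ρ(i, j)` at
chart sites of the star, and the push-forward weight is `invW_{(σ,b)}(x) = [ρ̂_b(x) ≤ n−1]·n/ρ̂_b(x)`.  With `r_V(x) = min(n, min_{v∈V} ρ̂_v(x))`
we get `n/r_V ≤ ω_V⁻¹ ≤ (1 + |V|)·n/r_V`, which is all the schedule needs (next file).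

## Contents ([folklore] `ZMod` arithmetic and finite sums on the tree's typed torus; 0 sorry)
* §1 `tau`, `rhoT`; `1 ≤ τ ≤ ρ̂`; Lipschitz under `± e_μ` and under `tstep μ m`.
* §2 the chart bridge: `τ_ν(emb σ b i j) = tIdx` of the coordinate on `[−n, n)²` (`M_ν ≥ 2`), `rhoT_emb`; every site is a chart site
  of every vertex with `tIdx` = `τ` (`exists_chart`); **`invW_le`**: `invW_v(x) ≤ n/ρ̂(x)`; **`le_invW`**: `ρ̂(x) ≤ n − 1 ⟹ n/ρ̂(x) ≤ invW_v(x)`.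
* (next file `DirichletVertexDistV`: `r_V = min(n, min_v ρ̂_v)`, its Lipschitz property, `n/r_V ≤ ω_V⁻¹ ≤ (1+|V|)·n/r_V`.)

ABSOLUTE RULE (cell, verbatim): «No internally-minted statement may enter as a cited fact. Every hypothesis is either kernel-proved in
this package or a verbatim quotation of a PUBLISHED theorem with page reference. The manuscript(s) under audit are NOT citable for
their own disputed steps — they are the thing under adjudication; programme-internal (2001/route/tribunal) claims are never citable.»
Nothing printed is a hypothesis; no estimate of any Bałaban object is made here.  NOT CLAIMED: (Φ)/(Φ′), (A′), the END (p234489 stays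
CONDITIONAL); NOT NE2, (CONV-C), `BetaPertH`, continuum, Clay.  «not in print; our proof attempt».  HONEST DEPENDENCY: continuum YM on T⁴ ⇐
BetaPertH ∧ nine spine estimates (0/9 proved); BetaPertH ⇐ (D1) ∧ (D4) ∧ CAP+tail; G-an2-4 gates asym, D1 and NE2/3/4.
-/

noncomputable section

open scoped BigOperators
open Finset

namespace Summit.QuantumFields.BalabanUV.Beta.GAN24.DirichletVertexDist

open Literature.MathematicalPhysics.QuantumFieldTheory.Balaban1983to89.B5Prop11Plancherel (Tor fine unitVec)
open Literature.MathematicalPhysics.QuantumFieldTheory.Balaban1983to89.B5Block118 (up upHom upHom_intCast tstep tstep_zero tstep_succ)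
open DirichletRingCutoff (tIdx one_le_tIdx)
open DirichletRingHessianWindow (rho)
open DirichletVertexChart
open DirichletVertexEnergy (invW omegaV invW_nonneg omegaV_pos inv_omegaV one_le_rho)

variable (n : ℕ) [NeZero n] (M : Fin 2 → ℕ) [hM : ∀ μ, NeZero (M μ)]

/-! ## §1 The torus ring distance to a block vertex -/

/-- the coordinate offset of `x` from the vertex `n·b` along axis `ν`, in `[0, n·M_ν)`. [folklore] -/
def wcoord (b : Tor M) (ν : Fin 2) (x : Tor (fine n M)) : ℕ := (x ν - up n M b ν).val

/-- the axis-`ν` ring index of `x` around the vertex `n·b`: `τ_ν(x) = min(w_ν + 1, n·M_ν − w_ν)`. [folklore] -/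
def tau (b : Tor M) (ν : Fin 2) (x : Tor (fine n M)) : ℕ := min (wcoord n M b ν x + 1) (n * M ν - wcoord n M b ν x)

/-- **THE TORUS RING INDEX** of `x` around the vertex `n·b`: `ρ̂_b(x) = max(τ_0(x), τ_1(x))`. [folklore] -/
def rhoT (b : Tor M) (x : Tor (fine n M)) : ℕ := max (tau n M b 0 x) (tau n M b 1 x)

/-- `w_ν < n·M_ν`. [folklore] -/
theorem wcoord_lt (b : Tor M) (ν : Fin 2) (x : Tor (fine n M)) : wcoord n M b ν x < n * M ν := ZMod.val_lt _

/-- `1 ≤ τ_ν`. [folklore] -/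
theorem one_le_tau (b : Tor M) (ν : Fin 2) (x : Tor (fine n M)) : 1 ≤ tau n M b ν x := by
  have := wcoord_lt n M b ν x
  unfold tau; omega

/-- `1 ≤ ρ̂`. [folklore] -/
theorem one_le_rhoT (b : Tor M) (x : Tor (fine n M)) : 1 ≤ rhoT n M b x :=
  (one_le_tau n M b 0 x).trans (le_max_left _ _)

omit [NeZero n] hM in
/-- `τ_ν ≤ ρ̂`. [folklore] -/
theorem tau_le_rhoT (b : Tor M) (ν : Fin 2) (x : Tor (fine n M)) : tau n M b ν x ≤ rhoT n M b x := by
  unfold rhoT; fin_cases ν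
  · exact le_max_left _ _
  · exact le_max_right _ _

/-- the offset after a unit step along axis `μ`: unchanged for `ν ≠ μ`, `+1 mod n·M_μ` for `ν = μ`. [folklore] -/
theorem wcoord_add_unitVec (b : Tor M) (μ ν : Fin 2) (x : Tor (fine n M)) :
    wcoord n M b ν (x + unitVec (fine n M) μ) = if ν = μ then (wcoord n M b ν x + 1) % (n * M ν) else wcoord n M b ν x := by
  unfold wcoord
  have e : (x + unitVec (fine n M) μ) ν - up n M b ν = (x ν - up n M b ν) + unitVec (fine n M) μ ν := by
    rw [Pi.add_apply]; ring
  rw [e, unitVec]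
  by_cases h : ν = μ
  · subst h
    rw [Pi.single_eq_same, if_pos rfl, ZMod.val_add, ZMod.val_one_eq_one_mod]
    show _ = _ % fine n M ν
    simp [Nat.add_mod]
  · rw [Pi.single_eq_of_ne h, add_zero, if_neg h]

/-- **LIPSCHITZ**: `τ_ν` changes by at most `1` under a unit step. [folklore] -/
theorem tau_add_unitVec_le (b : Tor M) (μ ν : Fin 2) (x : Tor (fine n M)) :
    tau n M b ν (x + unitVec (fine n M) μ) ≤ tau n M b ν x + 1 ∧ tau n M b ν x ≤ tau n M b ν (x + unitVec (fine n M) μ) + 1 := by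
  have hw := wcoord_lt n M b ν x
  unfold tau
  rw [wcoord_add_unitVec]
  split_ifs with h
  · subst h
    set w := wcoord n M b ν x
    set m := n * M ν
    rcases Nat.lt_or_ge (w + 1) m with h1 | h1
    · rw [Nat.mod_eq_of_lt h1]; constructor <;> omega
    · have hm : w + 1 = m := by omega
      rw [hm, Nat.mod_self]; constructor <;> omega
  · constructor <;> omega

/-- `ρ̂` is 1-Lipschitz under a unit step forward … [folklore] -/
theorem rhoT_add_unitVec_le (b : Tor M) (μ : Fin 2) (x : Tor (fine n M)) :
    rhoT n M b (x + unitVec (fine n M) μ) ≤ rhoT n M b x + 1 ∧ rhoT n M b x ≤ rhoT n M b (x + unitVec (fine n M) μ) + 1 := by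
  have h0 := tau_add_unitVec_le n M b μ 0 x
  have h1 := tau_add_unitVec_le n M b μ 1 x
  unfold rhoT
  constructor
  · exact max_le (by omega) (by omega)
  · exact max_le (by omega) (by omega)

/-- … and backward. [folklore] -/
theorem rhoT_sub_unitVec_le (b : Tor M) (μ : Fin 2) (x : Tor (fine n M)) :
    rhoT n M b (x - unitVec (fine n M) μ) ≤ rhoT n M b x + 1 ∧ rhoT n M b x ≤ rhoT n M b (x - unitVec (fine n M) μ) + 1 := by
  have h := rhoT_add_unitVec_le n M b μ (x - unitVec (fine n M) μ)
  rw [sub_add_cancel] at h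
  exact ⟨h.2, h.1⟩

/-- `ρ̂` changes by at most `m` under `m` steps forward … [folklore] -/
theorem rhoT_add_tstep_le (b : Tor M) (μ : Fin 2) (x : Tor (fine n M)) (m : ℕ) :
    rhoT n M b (x + tstep (fine n M) μ m) ≤ rhoT n M b x + m ∧ rhoT n M b x ≤ rhoT n M b (x + tstep (fine n M) μ m) + m := by
  induction m with
  | zero => simp [tstep_zero]
  | succ m ih =>
    have h := rhoT_add_unitVec_le n M b μ (x + tstep (fine n M) μ m)
    rw [tstep_succ, ← add_assoc]
    constructor <;> omega

/-- … and backward. [folklore] -/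
theorem rhoT_sub_tstep_le (b : Tor M) (μ : Fin 2) (x : Tor (fine n M)) (m : ℕ) :
    rhoT n M b (x - tstep (fine n M) μ m) ≤ rhoT n M b x + m ∧ rhoT n M b x ≤ rhoT n M b (x - tstep (fine n M) μ m) + m := by
  have h := rhoT_add_tstep_le n M b μ (x - tstep (fine n M) μ m) m
  rw [sub_add_cancel] at h
  exact ⟨h.2, h.1⟩

/-! ## §2 The chart bridge -/

section Chart

variable (σ : Fin 2 → Bool) (b : Tor M)

omit [NeZero n] in
/-- the chart minus the vertex is the reflected model coordinate: `(emb σ b i j) ν − (up b) ν = crd σ ν (i, j)_ν`. [folklore] -/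
theorem emb_sub_up (i j : ℤ) (ν : Fin 2) :
    emb n M σ b i j ν - up n M b ν = ((crd σ ν (cvec i j ν) : ℤ) : ZMod (fine n M ν)) := by
  rw [emb_apply]
  have hy : b ν = (((b ν).val : ℤ) : ZMod (M ν)) := by rw [Int.cast_natCast, ZMod.natCast_zmod_val]
  have hup : up n M b ν = (n : ZMod (fine n M ν)) * (((b ν).val : ℤ) : ZMod (fine n M ν)) := by
    show upHom n M ν (b ν) = _
    conv_lhs => rw [hy]
    exact upHom_intCast n M ν _
  rw [hup]
  push_cast
  ring

omit [NeZero n] hM in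
/-- the half-index is reflection-invariant. [folklore] -/
theorem tIdx_crd' (ν : Fin 2) (c : ℤ) : tIdx (crd σ ν c) = tIdx c := by
  unfold tIdx crd; split_ifs <;> omega

omit [NeZero n] hM in
/-- `crd` preserves the box `[−n, n)`. [folklore] -/
theorem crd_mem_box (ν : Fin 2) {c : ℤ} (hc : -(n : ℤ) ≤ c) (hc' : c < n) : -(n : ℤ) ≤ crd σ ν c ∧ crd σ ν c < n := by
  unfold crd; split_ifs <;> constructor <;> omega

omit [NeZero n] hM in
/-- the value of the class of an integer of the box `[−n, n)` modulo `m ≥ 2n`. [folklore] -/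
theorem val_intCast_box {m : ℕ} [NeZero m] {c : ℤ} (hc : -(n : ℤ) ≤ c) (hc' : c < n) (hm : 2 * n ≤ m) :
    (((c : ZMod m)).val : ℤ) = if 0 ≤ c then c else c + m := by
  rw [ZMod.val_intCast]
  split_ifs with h
  · exact Int.emod_eq_of_lt h (by omega)
  · have e : c % (m : ℤ) = (c + m) % (m : ℤ) := (Int.add_emod_right ..).symm
    rw [e]
    exact Int.emod_eq_of_lt (by omega) (by omega)

/-- **THE BRIDGE, coordinatewise**: at a chart site of the box `[−n, n)²` (`M_ν ≥ 2`), `τ_ν = tIdx` of the model coordinate. [folklore] -/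
theorem tau_emb {i j : ℤ} (hi : -(n : ℤ) ≤ i) (hi' : i < n) (hj : -(n : ℤ) ≤ j) (hj' : j < n) (hM2 : ∀ ν, 2 ≤ M ν) (ν : Fin 2) :
    (tau n M b ν (emb n M σ b i j) : ℤ) = tIdx (cvec i j ν) := by
  have hcν : -(n : ℤ) ≤ cvec i j ν ∧ cvec i j ν < n := by fin_cases ν <;> simp [cvec, hi, hi', hj, hj']
  obtain ⟨h1, h2⟩ := crd_mem_box n σ ν hcν.1 hcν.2
  have hm : 2 * n ≤ fine n M ν := by show 2 * n ≤ n * M ν; have := Nat.mul_le_mul_left n (hM2 ν); linarith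
  have hw : (wcoord n M b ν (emb n M σ b i j) : ℤ) = if 0 ≤ crd σ ν (cvec i j ν) then crd σ ν (cvec i j ν) else crd σ ν (cvec i j ν) + fine n M ν := by
    unfold wcoord
    rw [emb_sub_up]
    exact val_intCast_box n h1 h2 hm
  rw [← tIdx_crd' σ ν (cvec i j ν)]
  have hfine : ((fine n M ν : ℕ) : ℤ) = (n : ℤ) * (M ν : ℤ) := by simp [fine]
  unfold tau
  push_cast
  rw [hw]
  unfold tIdx
  split_ifs <;> push_cast <;> omega

/-- **THE BRIDGE**: `ρ̂_b(emb σ b i j) = ρ(i, j)` on the box `[−n, n)²` (`M_ν ≥ 2`). [folklore] -/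
theorem rhoT_emb {i j : ℤ} (hi : -(n : ℤ) ≤ i) (hi' : i < n) (hj : -(n : ℤ) ≤ j) (hj' : j < n) (hM2 : ∀ ν, 2 ≤ M ν) :
    (rhoT n M b (emb n M σ b i j) : ℤ) = rho i j := by
  have h0 := tau_emb n M σ b hi hi' hj hj' hM2 0
  have h1 := tau_emb n M σ b hi hi' hj hj' hM2 1
  simp only [cvec, Fin.isValue, Matrix.cons_val_zero, Matrix.cons_val_one] at h0 h1
  unfold rhoT rho
  push_cast
  rw [h0, h1]

/-- **EVERY SITE IS A CHART SITE OF EVERY VERTEX**, with half-indices `τ_0, τ_1`: `x = emb σ b i j`, `tIdx i = τ_0(x)`, `tIdx j = τ_1(x)`.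
[folklore] -/
theorem exists_chart (x : Tor (fine n M)) :
    ∃ i j : ℤ, x = emb n M σ b i j ∧ tIdx i = tau n M b 0 x ∧ tIdx j = tau n M b 1 x := by
  -- the signed representative of the offset
  set c : Fin 2 → ℤ := fun ν =>
    if wcoord n M b ν x + 1 ≤ n * M ν - wcoord n M b ν x then (wcoord n M b ν x : ℤ) else (wcoord n M b ν x : ℤ) - (n * M ν : ℕ)
    with hc
  have hcast : ∀ ν, ((c ν : ℤ) : ZMod (fine n M ν)) = x ν - up n M b ν := by
    intro ν
    have hw : ((wcoord n M b ν x : ℕ) : ZMod (fine n M ν)) = x ν - up n M b ν := ZMod.natCast_zmod_val _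
    simp only [hc]
    split_ifs
    · rw [Int.cast_natCast, hw]
    · rw [Int.cast_sub, Int.cast_natCast, hw, Int.cast_natCast]
      have : ((n * M ν : ℕ) : ZMod (fine n M ν)) = 0 := ZMod.natCast_self _
      rw [this, sub_zero]
  have htIdx : ∀ ν, tIdx (c ν) = tau n M b ν x := by
    intro ν
    have hw := wcoord_lt n M b ν x
    simp only [hc]
    unfold tau tIdx
    split_ifs <;> push_cast <;> omega
  refine ⟨crd σ 0 (c 0), crd σ 1 (c 1), ?_, by rw [tIdx_crd', htIdx], by rw [tIdx_crd', htIdx]⟩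
  funext ν
  have e := emb_sub_up n M σ b (crd σ 0 (c 0)) (crd σ 1 (c 1)) ν
  have hcrd : crd σ ν (cvec (crd σ 0 (c 0)) (crd σ 1 (c 1)) ν) = c ν := by
    fin_cases ν <;> simp only [cvec, Fin.zero_eta, Fin.mk_one, Fin.isValue, Matrix.cons_val_zero, Matrix.cons_val_one] <;>
      (unfold crd; split_ifs <;> ring)
  rw [hcrd, hcast] at e
  have := congrArg (· + up n M b ν) e
  simpa using this.symm

variable {σ b}

omit [NeZero n] hM in
/-- the hits of the push-forward at a point are unique (no wrap on `Q_K`, `2K ≤ n·M_ν`). [folklore] -/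
theorem hit_unique {K : ℕ} (h0 : 2 * K ≤ n * M 0) (h1 : 2 * K ≤ n * M 1) {x : Tor (fine n M)} {s t s' t' : ℕ}
    (hs : s < 2 * K) (ht : t < 2 * K) (hs' : s' < 2 * K) (ht' : t' < 2 * K)
    (e : x = emb n M σ b (-(K : ℤ) + s) (-(K : ℤ) + t)) (e' : x = emb n M σ b (-(K : ℤ) + s') (-(K : ℤ) + t')) : s = s' ∧ t = t' := by
  have := emb_injOn n M (σ := σ) (b := b) (a₀ := -(K : ℤ)) (a₁ := -(K : ℤ)) (W₀ := 2 * K) (W₁ := 2 * K) h0 h1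
    (i := -(K : ℤ) + s) (j := -(K : ℤ) + t) (i' := -(K : ℤ) + s') (j' := -(K : ℤ) + t')
    (by omega) (by omega) (by omega) (by omega) (by omega) (by omega) (by omega) (by omega) (e.symm.trans e')
  omega

/-- **UPPER BRIDGE**: `invW_{(σ,b)}(x) ≤ n/ρ̂_b(x)` at EVERY site (`2 ≤ n`, `M_ν ≥ 2`). [folklore] -/
theorem invW_le (hn : 2 ≤ n) (hM2 : ∀ ν, 2 ≤ M ν) (x : Tor (fine n M)) :
    invW n M (σ, b) (n - 1) x ≤ (n : ℝ) / rhoT n M b x := by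
  set K : ℕ := n - 1 with hK
  have h0 : 2 * K ≤ n * M 0 := by have := Nat.mul_le_mul_left n (hM2 0); omega
  have h1 : 2 * K ≤ n * M 1 := by have := Nat.mul_le_mul_left n (hM2 1); omega
  have hρ : (0 : ℝ) < rhoT n M b x := by exact_mod_cast one_le_rhoT n M b x
  -- the value of every hit term
  have hval : ∀ s t : ℕ, s < 2 * K → t < 2 * K → x = emb n M σ b (-(K : ℤ) + s) (-(K : ℤ) + t) →
      (n : ℝ) / (rho (-(K : ℤ) + s) (-(K : ℤ) + t) : ℝ) = (n : ℝ) / rhoT n M b x := by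
    intro s t hs ht e
    have h := rhoT_emb n M σ b (i := -(K : ℤ) + s) (j := -(K : ℤ) + t) (by omega) (by omega) (by omega) (by omega) hM2
    rw [← e] at h
    rw [← h, Int.cast_natCast]
  unfold invW
  simp only
  -- at most one hit
  by_cases hhit : ∃ s t : ℕ, s < 2 * K ∧ t < 2 * K ∧ x = emb n M σ b (-(K : ℤ) + s) (-(K : ℤ) + t)
  · obtain ⟨s₀, t₀, hs₀, ht₀, e₀⟩ := hhit
    rw [Finset.sum_eq_single t₀, Finset.sum_eq_single s₀, if_pos e₀, hval s₀ t₀ hs₀ ht₀ e₀]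
    · intro s hs hne
      rw [if_neg]
      intro e
      exact hne (hit_unique n M h0 h1 (mem_range.mp hs) ht₀ hs₀ ht₀ e e₀).1
    · intro h; exact absurd (mem_range.mpr hs₀) h
    · intro t ht hne
      refine Finset.sum_eq_zero fun s hs => ?_
      rw [if_neg]
      intro e
      exact hne (hit_unique n M h0 h1 (mem_range.mp hs) (mem_range.mp ht) hs₀ ht₀ e e₀).2
    · intro h; exact absurd (mem_range.mpr ht₀) h
  · push Not at hhit
    rw [Finset.sum_eq_zero]
    · positivity
    · intro t ht
      refine Finset.sum_eq_zero fun s hs => ?_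
      rw [if_neg (hhit s t (mem_range.mp hs) (mem_range.mp ht))]

/-- **LOWER BRIDGE**: on the window `ρ̂_b(x) ≤ n − 1`, `n/ρ̂_b(x) ≤ invW_{(σ,b)}(x)`. [folklore] -/
theorem le_invW {x : Tor (fine n M)} (hx : rhoT n M b x ≤ n - 1) :
    (n : ℝ) / rhoT n M b x ≤ invW n M (σ, b) (n - 1) x := by
  set K : ℕ := n - 1 with hK
  obtain ⟨i, j, e, hi, hj⟩ := exists_chart n M σ b x
  have hiK : tIdx i ≤ K := by rw [hi]; exact_mod_cast (tau_le_rhoT n M b 0 x).trans hx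
  have hjK : tIdx j ≤ K := by rw [hj]; exact_mod_cast (tau_le_rhoT n M b 1 x).trans hx
  have hti := one_le_tIdx i
  have htj := one_le_tIdx j
  obtain ⟨s, hs, rfl⟩ : ∃ s : ℕ, s < 2 * K ∧ -(K : ℤ) + s = i := ⟨(i + K).toNat, by unfold tIdx at hiK; split_ifs at hiK <;> omega,
    by unfold tIdx at hiK; split_ifs at hiK <;> omega⟩
  obtain ⟨t, ht, rfl⟩ : ∃ t : ℕ, t < 2 * K ∧ -(K : ℤ) + t = j := ⟨(j + K).toNat, by unfold tIdx at hjK; split_ifs at hjK <;> omega,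
    by unfold tIdx at hjK; split_ifs at hjK <;> omega⟩
  have hρ : (rho (-(K : ℤ) + s) (-(K : ℤ) + t) : ℤ) = rhoT n M b x := by
    unfold rho rhoT; rw [hi, hj]; push_cast; rfl
  have hρR : (rhoT n M b x : ℝ) = (rho (-(K : ℤ) + s) (-(K : ℤ) + t) : ℝ) := by exact_mod_cast hρ.symm
  rw [hρR]
  set g : ℕ → ℕ → ℝ := fun t' s' =>
    if x = emb n M σ b (-(K : ℤ) + s') (-(K : ℤ) + t') then (n : ℝ) / (rho (-(K : ℤ) + s') (-(K : ℤ) + t') : ℝ) else 0 with hg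
  have hg0 : ∀ t' s', 0 ≤ g t' s' := by
    intro t' s'; rw [hg]; simp only
    split_ifs
    · exact div_nonneg (Nat.cast_nonneg _) (by exact_mod_cast (le_trans zero_le_one (one_le_rho _ _)))
    · exact le_rfl
  have hgst : g t s = (n : ℝ) / (rho (-(K : ℤ) + s) (-(K : ℤ) + t) : ℝ) := by rw [hg]; simp only; rw [if_pos e]
  change (n : ℝ) / (rho (-(K : ℤ) + s) (-(K : ℤ) + t) : ℝ) ≤ ∑ t' ∈ range (2 * K), ∑ s' ∈ range (2 * K), g t' s'
  rw [← hgst]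
  calc g t s ≤ ∑ s' ∈ range (2 * K), g t s' := single_le_sum (f := fun s' => g t s') (fun s' _ => hg0 t s') (mem_range.mpr hs)
    _ ≤ ∑ t' ∈ range (2 * K), ∑ s' ∈ range (2 * K), g t' s' :=
        single_le_sum (f := fun t' => ∑ s' ∈ range (2 * K), g t' s') (fun t' _ => sum_nonneg fun s' _ => hg0 t' s') (mem_range.mpr ht)

end Chart

end Summit.QuantumFields.BalabanUV.Beta.GAN24.DirichletVertexDist

end
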